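import Summits.CriticalPhenomena.Ising3DConformalLimit.Theorems.CanonicalBranchRefutationInfraredExponentZeroSharpHalfBet
import Summits.CriticalPhenomena.Ising3DConformalLimit.Theorems.PerfectScreeningScreeningDichotomy
import Literature.Probability.LatticeModels.TwoPointSupNormMonotone
import HarnessLib

/-!
# Crux `EtaPositive` (stmt-CriticalPhenomena-2600): the window of the finite-size-scaling currency

Route `AnomalousForcesInteraction` (Ising3DConformalLimit), line `registered`. By
`EtaPositive_iff_boxSum_gain` (p165244) the crux is a power gain `Σ_{y ∈ Λ_L} ⟨σ₀σ_y⟩⁺_{β_c(3)} ≤ C L^{2-κ}`, `κ > 0`,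
on the box sums of the infinite-volume critical two-point function (`χ_L(β_c) ≲ L^{2-η}`). This file records the
window of that currency, unconditionally on `ℤ³`:

* `boxSum_frequently_ge_rpow` — **`χ_L(β_c(3)) ≥ c L^{3/2}` for infinitely many `L`**: the Duminil-Copin–Panis
  axis floor `c₀ n^{-3/2} ≤ ⟨σ₀σ_{ne₁}⟩` (infinitely often, `exists_frequently_mul_rpow_le_criticalTwoPoint_axis`)
  averaged over `Λ_{⌊n/3⌋}` by Messager–Miracle-Solé (`card_box_mul_twoPointPlus_le_sum_box`):
  `Σ_{Λ_L} ≥ (2L+1)³ c₀ n^{-3/2} ≥ (8c₀/25) L^{3/2}` (`n ≤ 5L`).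
* `boxSum_gain_exponent_le_half` — hence any box-sum bound `C L^{2-κ}` (`L ≥ 1`) has `κ ≤ 1/2` (equivalently: the
  MMS transport `criticalTwoPoint_decay_of_boxSum_le`, p165244, and the two-point window
  `EtaPositive_exponent_le_half`, p165507): the finite-size-scaling window of the crux is `2 - κ ∈ [3/2, 2)`.

No named fact is assumed; standard axioms.
-/

noncomputable section

namespace Summit.CriticalPhenomena.Ising3DConformalLimit.AnomalousForcesInteractionEtaPositive

open Filter Topology Finset Literature.Probability.LatticeModels

/-- **`χ_L(β_c(3)) ≥ c L^{3/2}` infinitely often.** There is `c > 0` such that the box sums of the critical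
two-point function of the nearest-neighbour Ising model on `ℤ³` satisfy `c L^{3/2} ≤ Σ_{y ∈ Λ_L} ⟨σ₀σ_y⟩⁺_{β_c(3)}`
for infinitely many `L` (DCP axis floor at exponent `3/2`, averaged over `Λ_{⌊n/3⌋}` by Messager–Miracle-Solé).
Registered stub of stmt-CriticalPhenomena-2600 (verbatim one-line header). [cite: DuminilCopinPanis2025LowerBounds, Theorem 1.3] -/
theorem boxSum_frequently_ge_rpow : ∃ c : ℝ, 0 < c ∧ ∃ᶠ L : ℕ in Filter.atTop, c * (L : ℝ) ^ (3 / 2 : ℝ) ≤ ∑ y ∈ Literature.Probability.LatticeModels.box 3 L, Literature.Probability.LatticeModels.criticalTwoPoint 3 y := by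
  obtain ⟨c, hc, hfreq⟩ :=
    Summit.CriticalPhenomena.Ising3DConformalLimit.Theorems.exists_frequently_mul_rpow_le_criticalTwoPoint_axis
  refine ⟨8 * c / 25, by positivity, ?_⟩
  rw [Filter.frequently_atTop]
  intro L₁
  obtain ⟨n, hn, hfloor⟩ := Filter.frequently_atTop.1 hfreq (3 * L₁ + 3)
  set L : ℕ := n / 3 with hLdef
  have hL₁ : L₁ ≤ L := by omega
  have hL1 : 1 ≤ L := by omega
  have h3L : 3 * L ≤ n := by omega
  have hn5L : n ≤ 5 * L := by omega
  refine ⟨L, hL₁, ?_⟩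
  have hβ : 0 ≤ criticalBeta 3 := criticalBeta_nonneg 3
  -- MMS averaged over `Λ_L`: `|Λ_L| ⟨σ₀σ_{ne₁}⟩ ≤ Σ_{Λ_L}`
  have hx : 3 * L ≤ Site.supNorm (Pi.single 0 (n : ℤ) : Site 3) := by
    rw [Summit.CriticalPhenomena.Ising3DConformalLimit.Theorems.PerfectScreening.supNorm_single_natCast]
    exact h3L
  have hMMS : (#(box 3 L) : ℝ) * criticalTwoPoint 3 (Pi.single 0 (n : ℤ)) ≤
      ∑ y ∈ box 3 L, criticalTwoPoint 3 y :=
    card_box_mul_twoPointPlus_le_sum_box (d := 3) hβ hx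
  have hcard : (#(box 3 L) : ℝ) = (2 * (L : ℝ) + 1) ^ 3 := by
    rw [card_box]; push_cast; ring
  have hL0 : (0 : ℝ) < L := by exact_mod_cast hL1
  have hn0 : (0 : ℝ) < n := by exact_mod_cast (by omega : 0 < n)
  -- `(2L+1)³ ≥ 8 L³ = 8 L^{3/2} L^{3/2}` and `n^{-3/2} ≥ L^{-3/2}/25`
  have hP : 8 * ((L : ℝ) ^ (3 / 2 : ℝ) * (L : ℝ) ^ (3 / 2 : ℝ)) ≤ (2 * (L : ℝ) + 1) ^ 3 := by
    have e : (L : ℝ) ^ (3 / 2 : ℝ) * (L : ℝ) ^ (3 / 2 : ℝ) = (L : ℝ) ^ 3 := by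
      rw [← Real.rpow_add hL0, ← Real.rpow_natCast]; norm_num
    rw [e]
    nlinarith [pow_le_pow_left₀ (by positivity : (0 : ℝ) ≤ 2 * L) (by linarith : 2 * (L : ℝ) ≤ 2 * L + 1) 3]
  have hfl : (L : ℝ) ^ (-(3 / 2 : ℝ)) / 25 ≤ (n : ℝ) ^ (-(3 / 2 : ℝ)) := by
    have hn5L' : (n : ℝ) ≤ 5 * L := by exact_mod_cast hn5L
    have h1 : (5 * (L : ℝ)) ^ (-(3 / 2 : ℝ)) ≤ (n : ℝ) ^ (-(3 / 2 : ℝ)) :=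
      Real.rpow_le_rpow_of_nonpos hn0 hn5L' (by norm_num)
    have h2 : (5 * (L : ℝ)) ^ (-(3 / 2 : ℝ)) = (5 : ℝ) ^ (-(3 / 2 : ℝ)) * (L : ℝ) ^ (-(3 / 2 : ℝ)) :=
      Real.mul_rpow (by norm_num) hL0.le
    have h3 : (1 / 25 : ℝ) ≤ (5 : ℝ) ^ (-(3 / 2 : ℝ)) := by
      rw [Real.rpow_neg (by norm_num), ← one_div]
      apply one_div_le_one_div_of_le (Real.rpow_pos_of_pos (by norm_num) _)
      calc (5 : ℝ) ^ (3 / 2 : ℝ) ≤ (5 : ℝ) ^ ((2 : ℕ) : ℝ) :=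
            Real.rpow_le_rpow_of_exponent_le (by norm_num) (by norm_num)
        _ = 25 := by rw [Real.rpow_natCast]; norm_num
    have hLp : 0 ≤ (L : ℝ) ^ (-(3 / 2 : ℝ)) := Real.rpow_nonneg hL0.le _
    calc (L : ℝ) ^ (-(3 / 2 : ℝ)) / 25 = (1 / 25) * (L : ℝ) ^ (-(3 / 2 : ℝ)) := by ring
      _ ≤ (5 : ℝ) ^ (-(3 / 2 : ℝ)) * (L : ℝ) ^ (-(3 / 2 : ℝ)) := by gcongr
      _ = (5 * (L : ℝ)) ^ (-(3 / 2 : ℝ)) := h2.symm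
      _ ≤ (n : ℝ) ^ (-(3 / 2 : ℝ)) := h1
  have hinv : (L : ℝ) ^ (3 / 2 : ℝ) * (L : ℝ) ^ (-(3 / 2 : ℝ)) = 1 := by
    rw [← Real.rpow_add hL0]; norm_num
  have hG0 : 0 ≤ criticalTwoPoint 3 (Pi.single 0 (n : ℤ)) := criticalTwoPoint_nonneg' _
  have hp32 : 0 ≤ (L : ℝ) ^ (3 / 2 : ℝ) := Real.rpow_nonneg hL0.le _
  calc 8 * c / 25 * (L : ℝ) ^ (3 / 2 : ℝ)
      = 8 * ((L : ℝ) ^ (3 / 2 : ℝ) * (L : ℝ) ^ (3 / 2 : ℝ)) * (c * ((L : ℝ) ^ (-(3 / 2 : ℝ)) / 25)) := by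
        have : 8 * c / 25 * (L : ℝ) ^ (3 / 2 : ℝ) =
            8 * c / 25 * (L : ℝ) ^ (3 / 2 : ℝ) * ((L : ℝ) ^ (3 / 2 : ℝ) * (L : ℝ) ^ (-(3 / 2 : ℝ))) := by
          rw [hinv, mul_one]
        rw [this]; ring
    _ ≤ (2 * (L : ℝ) + 1) ^ 3 * (c * (n : ℝ) ^ (-(3 / 2 : ℝ))) := by gcongr
    _ ≤ (2 * (L : ℝ) + 1) ^ 3 * criticalTwoPoint 3 (Pi.single 0 (n : ℤ)) :=
        mul_le_mul_of_nonneg_left hfloor (by positivity)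
    _ ≤ ∑ y ∈ box 3 L, criticalTwoPoint 3 y := by rw [← hcard]; exact hMMS

/-- **The window of the finite-size-scaling currency.** Any box-sum bound `Σ_{y ∈ Λ_L} ⟨σ₀σ_y⟩⁺_{β_c(3)} ≤ C L^{2-κ}`
for all `L ≥ 1` has `κ ≤ 1/2`: against the floor `boxSum_frequently_ge_rpow`, `c L^{3/2} ≤ C L^{2-κ}` infinitely often
forces `c ≤ C L^{1/2-κ} → 0` if `κ > 1/2`. So the exponent of the crux in susceptibility form lives in
`2 - κ ∈ [3/2, 2)`. Registered stub of stmt-CriticalPhenomena-2600 (verbatim one-line header). -/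
theorem boxSum_gain_exponent_le_half : ∀ κ C : ℝ, (∀ L : ℕ, 1 ≤ L → ∑ y ∈ Literature.Probability.LatticeModels.box 3 L, Literature.Probability.LatticeModels.criticalTwoPoint 3 y ≤ C * (L : ℝ) ^ (2 - κ)) → κ ≤ 1 / 2 := by
  intro κ C h
  by_contra hκ
  push Not at hκ
  obtain ⟨c, hc, hfreq⟩ := boxSum_frequently_ge_rpow
  have hlim : Tendsto (fun L : ℕ => C * (L : ℝ) ^ (-(κ - 1 / 2))) atTop (𝓝 0) := by
    have h1 : Tendsto (fun t : ℝ => t ^ (-(κ - 1 / 2))) atTop (𝓝 0) :=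
      tendsto_rpow_neg_atTop (y := κ - 1 / 2) (by linarith)
    have h2 : Tendsto (fun L : ℕ => (L : ℝ) ^ (-(κ - 1 / 2))) atTop (𝓝 0) :=
      h1.comp tendsto_natCast_atTop_atTop
    simpa only [mul_zero] using h2.const_mul C
  have hev : ∀ᶠ L : ℕ in atTop, C * (L : ℝ) ^ (-(κ - 1 / 2)) < c := hlim.eventually (gt_mem_nhds hc)
  obtain ⟨L, hfloor, hlt, hL1⟩ := (hfreq.and_eventually (hev.and (eventually_ge_atTop 1))).exists
  have hL0 : (0 : ℝ) < L := by exact_mod_cast hL1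
  have hchain : c * (L : ℝ) ^ (3 / 2 : ℝ) ≤ C * (L : ℝ) ^ (2 - κ) := hfloor.trans (h L hL1)
  have hp : 0 < (L : ℝ) ^ (-(3 / 2 : ℝ)) := Real.rpow_pos_of_pos hL0 _
  have hmul := mul_le_mul_of_nonneg_right hchain hp.le
  have e1 : c * (L : ℝ) ^ (3 / 2 : ℝ) * (L : ℝ) ^ (-(3 / 2 : ℝ)) = c := by
    rw [mul_assoc, ← Real.rpow_add hL0]; norm_num
  have e2 : C * (L : ℝ) ^ (2 - κ) * (L : ℝ) ^ (-(3 / 2 : ℝ)) = C * (L : ℝ) ^ (-(κ - 1 / 2)) := by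
    rw [mul_assoc, ← Real.rpow_add hL0]
    congr 2; ring
  rw [e1, e2] at hmul
  linarith

end Summit.CriticalPhenomena.Ising3DConformalLimit.AnomalousForcesInteractionEtaPositive
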